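import Literature.NumberTheory.Transcendental.LinGroupKAssembly
import Literature.NumberTheory.Transcendental.RoyRankGenericFromLST
import HarnessLib

/-!
# From the assembled Linear Subgroup Theorem on `𝔾ₐ^{d₀} × 𝔾ₘ^{d₁}` to Roy's Theorem 1: the obstruction in Roy's terms

Topic `Literature/NumberTheory/Transcendental` (namespace `Literature.NumberTheory.Transcendental`,
grouping sub-namespace `LinGroupK`). Everything here is PROVED; definitions with bodies (the point
homomorphism `gammaOf y α` and the rational parametrisation `lattQ y`); no named facts.

Glue between the field-generic §7 assembly `LinGroupK.weakObstruction_of_zeroEstimate_of_auxiliary`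
(`LinGroupKAssembly.lean`, [Waldschmidt1988, §7]) and the field-generic Roy-side link
`RoyRank.thm1_zero_of_linearSubgroupTheorem_weak` (`RoyRankGenericFromLST.lean`, [Roy1992, §1
Theorem 1]), for Roy's data `(K, F, L)` without periods (`ω = 0`, the `p`-adic case
"`K = ℂ_p`" of [Roy1992]). Given one of Roy's objects `(Y, W, V)` together with

* a `ℚ`-basis `y₁, …, y_m` of `Y` and units `αᵢⱼ ∈ Kˣ` playing `exp(yᵢⱼ)` — the point
  homomorphism is `γ(h) = (∑ᵢ hᵢ yᵢ⁰, (∏ᵢ αᵢⱼ^{hᵢ})ⱼ)` (`gammaOf`), and the only property of the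
  exponential that the assembly needs is the **logarithmic relation** `hrel`: a multiplicative
  relation `∏ⱼ (∏ᵢ αᵢⱼ^{kᵢ})^{χⱼ} = 1` forces the linear relation `∑ⱼ χⱼ (∑ᵢ kᵢ yᵢⱼ) = 0`
  (over `ℂ_p`: `yᵢⱼ = log αᵢⱼ` with `log` a homomorphism on principal units; over `ℂ` this fails by
  `2πi`, which is why the complex chain carries `Ω`),
* the zero estimate over `K` (`hZE`) and the auxiliary functions along `W` at the points `γ(h)`
  (`hAF`, [Waldschmidt1988, Prop. 6.1] in the shape consumed by the assembly),

`LinGroupK.royObstruction_of_zeroEstimate_of_auxiliary` produces the obstruction in exactly the shape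
consumed by `RoyRank.thm1_zero_of_linearSubgroupTheorem_weak`: `T_{G'} = E × T` with `T` spanned by
its `ℚ`-points (`ConnAlgSubgroup.torusTangent_le_span_rat`, the kernel of a rational matrix,
[Roy1992, Notations]; tree `Roy1992.ker_mulVecLin_map`), `E × T + W ≠ ⊤`, and
`(dim_ℚ Y − dim_ℚ(Y ∩ T_{G'}) + (d₁ − dim T))(d₀ + d₁ − dim V) ≤ (d₀ + d₁ − dim(T_{G'} + W)) d₁`
(`λ = m − dim_ℚ φ⁻¹(T_{G'})` read through the basis, `finrank_comap_lattQ`).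

## References

* [Waldschmidt1988] M. Waldschmidt, *On the transcendence methods of Gel'fond and Schneider in
  several variables*, New Advances in Transcendence Theory (A. Baker ed.), CUP 1988, 375–398:
  §4 Theorem 4.1 (pp. 382–383); §6 Proposition 6.1 (p. 389); §7 (p. 390).
* [Roy1992] D. Roy, *Matrices whose coefficients are linear forms in logarithms*, J. Number
  Theory 41 (1992) 22–47: Notations (p. 24); §1 Theorem 1 (p. 25).
* [NesterenkoPhilippon2001] Yu. V. Nesterenko, P. Philippon (eds.), *Introduction to Algebraic
  Independence Theory*, LNM 1752, Springer 2001, Ch. 11 (D. Roy), proof of Cor. 4.2 (p. 222).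
-/

noncomputable section

namespace Literature.NumberTheory.Transcendental.LinGroupK

open Module Submodule
open Literature.NumberTheory.Transcendental.LinGroup (auxDelta)
open Literature.Barriers.Schanuel.Roy1992 (incl incl_apply spanK ker_mulVecLin_map)

variable {K : Type*} [Field K] [CharZero K] {d₀ d₁ m : ℕ}

/-! ### The point homomorphism `γ(h) = (∑ hᵢ yᵢ⁰, ∏ αᵢⱼ^{hᵢ})` -/

/-- **The points `γ(h)`** attached to tangent vectors `y₁, …, y_m ∈ K^{d₀} × K^{d₁}` and units
`αᵢⱼ ∈ Kˣ` (playing `exp(yᵢⱼ)`): `γ(h) = (∑ᵢ hᵢ yᵢ⁰, (∏ᵢ αᵢⱼ^{hᵢ})ⱼ) ∈ G(K)`, a homomorphism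
`ℤ^m → G(K)` (for `αᵢⱼ = exp(yᵢⱼ)` it is `h ↦ exp_G(h₁y₁ + ⋯ + h_my_m)`).
[cite: Waldschmidt1988, §6 (p. 389: `Γ(S) = exp_G Y(S)`)] -/
def gammaOf (y : Fin m → (Fin d₀ → K) × (Fin d₁ → K)) (α : Fin m → Fin d₁ → Kˣ) :
    Multiplicative (Fin m → ℤ) →* LinGroupK K d₀ d₁ where
  toFun k := (Multiplicative.ofAdd (∑ i, (Multiplicative.toAdd k i : K) • (y i).1),
    fun j => ∏ i, α i j ^ (Multiplicative.toAdd k i))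
  map_one' := by
    refine Prod.ext ?_ ?_
    · simp
    · funext j
      simp
  map_mul' k k' := by
    refine Prod.ext ?_ ?_
    · apply Multiplicative.toAdd.injective
      simp only [toAdd_mul, Pi.add_apply, Int.cast_add, add_smul, Finset.sum_add_distrib, toAdd_ofAdd,
        Prod.fst_mul]
    · funext j
      simp only [toAdd_mul, Pi.add_apply, zpow_add, Finset.prod_mul_distrib, Prod.snd_mul, Pi.mul_apply]

omit [CharZero K] in
/-- The additive coordinates of `γ(k)`. [folklore] -/
@[simp] theorem toAdd_gammaOf_fst (y : Fin m → (Fin d₀ → K) × (Fin d₁ → K)) (α : Fin m → Fin d₁ → Kˣ)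
    (k : Fin m → ℤ) :
    Multiplicative.toAdd (gammaOf y α (Multiplicative.ofAdd k)).1 = ∑ i, (k i : K) • (y i).1 := by
  simp [gammaOf]

omit [CharZero K] in
/-- The multiplicative coordinates of `γ(k)`. [folklore] -/
@[simp] theorem gammaOf_snd (y : Fin m → (Fin d₀ → K) × (Fin d₁ → K)) (α : Fin m → Fin d₁ → Kˣ)
    (k : Fin m → ℤ) (j : Fin d₁) :
    (gammaOf y α (Multiplicative.ofAdd k)).2 j = ∏ i, α i j ^ k i := by
  simp [gammaOf]

/-! ### The rational parametrisation `φ : ℚ^m → K^{d₀} × K^{d₁}`, `q ↦ ∑ qᵢ yᵢ` -/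

/-- `φ(q) = ∑ᵢ qᵢ yᵢ`. [cite: Roy1992, §1 Theorem 1 (p. 25): `Y` a finite dimensional `ℚ`-subspace] -/
def lattQ (y : Fin m → (Fin d₀ → K) × (Fin d₁ → K)) : (Fin m → ℚ) →ₗ[ℚ] (Fin d₀ → K) × (Fin d₁ → K) :=
  Fintype.linearCombination ℚ y

/-- `φ(q) = ∑ᵢ qᵢ yᵢ`. [folklore] -/
theorem lattQ_apply (y : Fin m → (Fin d₀ → K) × (Fin d₁ → K)) (q : Fin m → ℚ) :
    lattQ y q = ∑ i, q i • y i :=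
  Fintype.linearCombination_apply ℚ y q

/-- The image of `φ` is `ℚy₁ + ⋯ + ℚy_m`. [folklore] -/
theorem range_lattQ (y : Fin m → (Fin d₀ → K) × (Fin d₁ → K)) :
    LinearMap.range (lattQ y) = span ℚ (Set.range y) :=
  Fintype.range_linearCombination ℚ y

/-- On integer vectors: `φ(k) = (∑ kᵢ yᵢ⁰, ∑ kᵢ yᵢ¹)`. [folklore] -/
theorem lattQ_intCast (y : Fin m → (Fin d₀ → K) × (Fin d₁ → K)) (k : Fin m → ℤ) :
    lattQ y (fun i => (k i : ℚ)) = (∑ i, (k i : K) • (y i).1, ∑ i, (k i : K) • (y i).2) := by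
  rw [lattQ_apply]
  have e : ∀ i, ((k i : ℚ)) • y i = (k i : K) • y i := fun i => by
    rw [Int.cast_smul_eq_zsmul, Int.cast_smul_eq_zsmul]
  simp only [e]
  refine Prod.ext ?_ ?_
  · rw [Prod.fst_sum]
    rfl
  · rw [Prod.snd_sum]
    rfl

/-- For linearly independent `yᵢ`, `dim_ℚ φ⁻¹(X) = dim_ℚ(span y ∩ X)`. [folklore] -/
theorem finrank_comap_lattQ {y : Fin m → (Fin d₀ → K) × (Fin d₁ → K)} (hy : LinearIndependent ℚ y)
    (X : Submodule ℚ ((Fin d₀ → K) × (Fin d₁ → K))) :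
    finrank ℚ (X.comap (lattQ y)) = finrank ℚ ↥(span ℚ (Set.range y) ⊓ X) := by
  have hinj : Function.Injective (lattQ y) := hy.fintypeLinearCombination_injective
  rw [LinearEquiv.finrank_eq (Submodule.equivMapOfInjective _ hinj _), Submodule.map_comap_eq,
    range_lattQ]

/-! ### `Lie T'` is rational over `ℚ` -/

namespace ConnAlgSubgroup

omit [CharZero K] in
/-- The character group `M ≤ ℤ^{d₁}` is finitely generated. [folklore] -/
theorem exists_chars_generators (H : ConnAlgSubgroup K d₀ d₁) :
    ∃ (r : ℕ) (χ : Fin r → Fin d₁ → ℤ), (∀ k, χ k ∈ H.chars) ∧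
      ∀ ψ ∈ H.chars, ψ ∈ Submodule.span ℤ (Set.range χ) := by
  have hfg : (AddSubgroup.toIntSubmodule H.chars).FG := IsNoetherian.noetherian _
  obtain ⟨r, χ, hχ⟩ := Submodule.fg_iff_exists_fin_generating_family.1 hfg
  refine ⟨r, χ, fun k => ?_, fun ψ hψ => ?_⟩
  · have : χ k ∈ Submodule.span ℤ (Set.range χ) := Submodule.subset_span ⟨k, rfl⟩
    rw [hχ] at this
    exact this
  · rw [hχ]
    exact hψ

omit [CharZero K] in
/-- A `ℤ`-linear identity holding on generators of `M` holds on `M`. [folklore] -/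
theorem sum_mul_eq_zero_of_generators {r : ℕ} {χ : Fin r → Fin d₁ → ℤ} {ψ : Fin d₁ → ℤ}
    (hψ : ψ ∈ Submodule.span ℤ (Set.range χ)) (v : Fin d₁ → K)
    (hv : ∀ k, ∑ j, (χ k j : K) * v j = 0) : ∑ j, (ψ j : K) * v j = 0 := by
  induction hψ using Submodule.span_induction with
  | mem x hx =>
    obtain ⟨k, rfl⟩ := hx
    exact hv k
  | zero => simp
  | add x y _ _ hx hy =>
    simp only [Pi.add_apply, Int.cast_add, add_mul, Finset.sum_add_distrib, hx, hy, add_zero]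
  | smul a x _ hx =>
    simp only [Pi.smul_apply, smul_eq_mul, Int.cast_mul, mul_assoc, ← Finset.mul_sum, hx,
      mul_zero]

/-- **`Lie T'` is rational over `ℚ`**: it is spanned by its vectors with rational coordinates (the
kernel of the rational matrix of a system of generators of `M`; `Roy1992.ker_mulVecLin_map`).
[cite: Roy1992, Notations (p. 24)] -/
theorem torusTangent_le_span_rat (H : ConnAlgSubgroup K d₀ d₁) :
    H.torusTangent ≤ span K {v | v ∈ H.torusTangent ∧ ∀ j, v j ∈ Set.range (algebraMap ℚ K)} := by
  obtain ⟨r, χ, hχ, hgen⟩ := H.exists_chars_generators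
  let A : Matrix (Fin r) (Fin d₁) ℚ := fun k j => (χ k j : ℚ)
  have hmap : ∀ k j, (A.map (algebraMap ℚ K)) k j = (χ k j : K) := by
    intro k j
    simp [A, Matrix.map_apply]
  have hker : H.torusTangent = LinearMap.ker (A.map (algebraMap ℚ K)).mulVecLin := by
    ext v
    rw [mem_torusTangent_iff, LinearMap.mem_ker, Matrix.mulVecLin_apply]
    constructor
    · intro hv
      funext k
      rw [Matrix.mulVec, dotProduct, Pi.zero_apply]
      simp only [hmap]
      exact hv (χ k) (hχ k)
    · intro hv ψ hψ
      refine sum_mul_eq_zero_of_generators (hgen ψ hψ) v fun k => ?_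
      have := congrFun hv k
      rw [Matrix.mulVec, dotProduct, Pi.zero_apply] at this
      simpa only [hmap] using this
  intro v hv
  have hv' : v ∈ spanK K (LinearMap.ker A.mulVecLin) := by
    rw [← ker_mulVecLin_map, ← hker]
    exact hv
  rw [spanK] at hv'
  refine Submodule.span_mono ?_ hv'
  rintro _ ⟨q, hq, rfl⟩
  refine ⟨?_, fun j => ⟨q j, by rw [incl_apply]⟩⟩
  have : incl ℚ K d₁ q ∈ spanK K (LinearMap.ker A.mulVecLin) :=
    Submodule.subset_span ⟨q, hq, rfl⟩
  rw [← ker_mulVecLin_map, ← hker] at this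
  exact this

end ConnAlgSubgroup

/-! ### The obstruction in Roy's terms -/

set_option maxHeartbeats 400000 in
/-- **The obstruction of the Linear Subgroup Theorem in Roy's terms** (data `(K, F, L)`, no
periods). Let `(Y, W, V)` be one of Roy's objects, `y₁, …, y_m` a `ℚ`-basis of `Y`, `αᵢⱼ ∈ Kˣ`
units satisfying the logarithmic relation `hrel` (`∏ⱼ (∏ᵢ αᵢⱼ^{kᵢ})^{χⱼ} = 1 ⟹ ∑ⱼ χⱼ ∑ᵢ kᵢ yᵢⱼ = 0`),
and assume the zero estimate over `K` and the auxiliary functions along `W` at the points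
`γ(h) = (∑ hᵢyᵢ⁰, ∏ αᵢⱼ^{hᵢ})`, `0 ≤ hⱼ ≤ S` (with `n = dim V` in `Δ`). Then there are `E ⊆ K^{d₀}`
and a `ℚ`-rational `T ⊆ K^{d₁}` with `E × T + W ≠ ⊤` and
`(dim_ℚ Y − dim_ℚ(Y ∩ (E × T)) + (d₁ − dim T))(d₀ + d₁ − dim V) ≤ (d₀ + d₁ − dim(E × T + W)) d₁` —
the hypothesis of `RoyRank.thm1_zero_of_linearSubgroupTheorem_weak` for this object.
[cite: Waldschmidt1988, §4 Theorem 4.1 (pp. 382–383); §7 (p. 390)] [cite: Roy1992, §1 Theorem 1 (p. 25)] -/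
theorem royObstruction_of_zeroEstimate_of_auxiliary
    {Y : Submodule ℚ ((Fin d₀ → K) × (Fin d₁ → K))}
    {W V : Submodule K ((Fin d₀ → K) × (Fin d₁ → K))} (hV : V ≠ ⊤)
    (y : Fin m → (Fin d₀ → K) × (Fin d₁ → K)) (hy : LinearIndependent ℚ y)
    (hyY : span ℚ (Set.range y) = Y) (α : Fin m → Fin d₁ → Kˣ)
    (hrel : ∀ (χ : Fin d₁ → ℤ) (k : Fin m → ℤ), (∏ j, (∏ i, α i j ^ k i) ^ χ j) = 1 →
      ∑ j, (χ j : K) * (∑ i, (k i : K) • (y i).2) j = 0)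
    (hZE : ZeroEstimate K d₀ d₁)
    (hAF : ∃ (C : ℝ) (S₀ : ℕ), 1 ≤ C ∧ ∀ S : ℕ, S₀ ≤ S →
      ∃ (P : MvPolynomial (Fin d₀ ⊕ Fin d₁) K) (T : ℕ), P ≠ 0 ∧
        auxDelta C d₀ d₁ (finrank K V) S / Real.log S ≤ T ∧
        (degX P : ℝ) ≤ auxDelta C d₀ d₁ (finrank K V) S / Real.log S ^ 2 ∧
        (degY P : ℝ) ≤ auxDelta C d₀ d₁ (finrank K V) S / S ∧
        ∀ h : Fin m → ℕ, (∀ j, h j ≤ S) →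
          VanishesAlg P W (gammaOf y α (Multiplicative.ofAdd fun j => (h j : ℤ))) T) :
    ∃ (E : Submodule K (Fin d₀ → K)) (T : Submodule K (Fin d₁ → K)),
      T ≤ span K {v | v ∈ T ∧ ∀ j, v j ∈ Set.range (algebraMap ℚ K)} ∧
      E.prod T ⊔ W ≠ ⊤ ∧
      (finrank ℚ Y - finrank ℚ ↥(Y ⊓ (E.prod T).restrictScalars ℚ) + (d₁ - finrank K T)) *
          (d₀ + d₁ - finrank K V) ≤
        (d₀ + d₁ - finrank K ↥(E.prod T ⊔ W)) * d₁ := by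
  -- `n = dim V < d₀ + d₁`
  have hn : finrank K V < d₀ + d₁ := by
    refine lt_of_le_of_ne ?_ fun heq => hV ?_
    · have := Submodule.finrank_le V
      rwa [finrank_lie] at this
    · exact Submodule.eq_top_of_finrank_eq (by rw [finrank_lie]; exact heq)
  -- the lattice of an obstruction lies in `φ⁻¹(T_{G'})`
  set Q : ConnAlgSubgroup K d₀ d₁ → Submodule ℚ (Fin m → ℚ) := fun H =>
    (H.tangent.restrictScalars ℚ).comap (lattQ y) with hQdef
  have hQ : ∀ (H : ConnAlgSubgroup K d₀ d₁) (k : Fin m → ℤ),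
      gammaOf y α (Multiplicative.ofAdd k) ∈ H.toSubgroup → (fun j => (k j : ℚ)) ∈ Q H := by
    intro H k hk
    rw [H.mem_toSubgroup_iff] at hk
    obtain ⟨hk0, hk1⟩ := hk
    rw [toAdd_gammaOf_fst] at hk0
    show lattQ y (fun j => (k j : ℚ)) ∈ H.tangent
    rw [lattQ_intCast, H.mem_tangent_iff]
    refine ⟨hk0, ?_⟩
    rw [H.mem_torusTangent_iff]
    intro χ hχ
    refine hrel χ k ?_
    have := hk1 χ hχ
    simp only [gammaOf_snd] at this
    exact this
  obtain ⟨H, hne, hineq⟩ :=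
    weakObstruction_of_zeroEstimate_of_auxiliary (gammaOf y α) Q W hQ hZE hn hAF
  refine ⟨H.addPart, H.torusTangent, H.torusTangent_le_span_rat, hne, ?_⟩
  -- read `λ` through the basis: `m = dim_ℚ Y`, `dim_ℚ Q(G') = dim_ℚ(Y ∩ T_{G'})`
  have hm : finrank ℚ Y = m := by
    rw [← hyY, finrank_span_eq_card hy, Fintype.card_fin]
  have hQH : finrank ℚ (Q H) = finrank ℚ ↥(Y ⊓ (H.addPart.prod H.torusTangent).restrictScalars ℚ) := by
    rw [hQdef]
    simp only
    rw [finrank_comap_lattQ hy, hyY]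
    rfl
  rw [hm, ← hQH]
  exact hineq

end Literature.NumberTheory.Transcendental.LinGroupK
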